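import Literature.Geometry.Symplectic.LefschetzSteinRealisation
import Literature.Geometry.Symplectic.LefschetzSteinOpenBook
import Literature.Geometry.Symplectic.FoldFormsFourFoldsSteinGlue
import Literature.Geometry.Symplectic.ContactFormSignPropagation
import HarnessLib

/-!
# Baykur's Stein realisation (named fact `steinRealisation_of_sorted_modelsOnFibred`) reduced to
# its topological half and "PALF ⇒ Stein supported by the Kas open book"

Topic `Literature/Geometry/Symplectic`; namespace `Literature.Geometry.Symplectic`.  A proofs-only
companion of `LefschetzSteinRealisation.lean` (the named fact
`Literature.Geometry.Symplectic.steinRealisation_of_sorted_modelsOnFibred`, Baykur 2006, proof of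
Thm. 5.1, pp. 13–14; "NF6" below) and of `LefschetzSteinOpenBook.lean` (the named fact
`Literature.Geometry.Symplectic.palf_stein_supportedByBoundaryOpenBook`, Akbulut–Ozbagci 2001 Thm. 5
with Gay 2002 Prop. 2.8; "S2").  Nothing is defined and no named fact is introduced: the one theorem
of this file PROVES NF6 from S2 and from the purely topological half of Baykur's argument, displayed
inline as the hypothesis `hT` ("dual Kas presentation of a sorted fibred model").

## The printed proof and its two halves

Baykur, proof of Thm. 5.1 (arXiv:math/0601396, pp. 13–14), for the closed-up achiral Lefschetz
fibration of a fibred model whose Hurwitz word is sorted `P ++ N` (positive letters first):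

* **topological half (p. 13).**  *"we get a disk enclosing only positive critical points … `μ₊`
  defines a positive Lefschetz fibration on `X₊` and `μ₋` defines a negative fibration on `X₋`. To
  recover the original 4-manifold `X` we need to put back in `S¹ × D³`, which has the same effect
  as gluing each other the tubular neighborhoods … of the bindings of open books on `∂X₊` and `∂X₋`
  … Noting that the NALF on `X₋` becomes a PALF on `−X₋`, we see that both PALFs induce the same
  open book decomposition on their boundaries."*  In the tree's vocabulary
  (`Literature/Topology/FourManifolds/LefschetzHandlebody.lean`, `LefschetzSteinOpenBook.lean`): from
  `ModelsOnFibred M g (P ++ N)` one gets `M = X₁ ∪_φ W₂` (`IsBoundaryGluing`) with `X₁ = X(F; P)`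
  (`IsLefschetzHandlebody g P X₁`) presented as a POSITIVE ALLOWABLE Lefschetz handlebody over the
  standard base `Base g ⊂ ℂ²` (attaching circles in pages, non-zero shadows, page twisting `−1`;
  multi-attachment data `D₁`), `W₂` (print's `−X₋`) presented likewise (`h₂`, `D₂`), ONE open book
  `ob` on `∂X₁` which is the Kas boundary open book of BOTH presentations (`IsKasOpenBookOf`, the
  second read through `φ`), one seam point at which the complex boundary orientations of the two
  presentations give a common positive frame (`IsPosBdryFrame`), and `∂X₁` connected.  This is the
  hypothesis `hT` below, stated verbatim in that vocabulary;
* **Stein/contact half (p. 14).**  *"By [LP, AO], both `X₊` and `−X₋` admit Stein structures … as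
  shown by Gay, the new open book on `∂Xᵢ` will be compatible with the new induced contact
  structure"* — the named fact S2, applied to each of the two presentations with the SAME open book.

NF6 then follows (`steinRealisation_of_sorted_modelsOnFibred_of_dualKasPresentation`): S2 on
`(X₁, h₁, D₁, b₁, ob)` gives `S₁, α₁`; S2 on `(W₂, h₂, D₂)` read on the re-indexed boundary datum
`reindexBoundaryData b₂ φ` (carrier `∂X₁`, inclusion `b₂.incl ∘ φ`; `FoldFormsFourFoldsSteinGlue.lean`)
gives `S₂, α₂`, a Giroux form for the pulled-back plane field by the chain rule; both `α₁ ∧ dα₁` and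
`α₂ ∧ dα₂` are positive on the common frame at the seam point, so the sign clause of NF6 holds
everywhere on the connected seam (`wedge₁₂_mextDeriv_pos_iff_of_exists`,
`ContactFormSignPropagation.lean`).

## Status of the two hypotheses (2026-08-17)

* `hS2` is the named fact `palf_stein_supportedByBoundaryOpenBook` (accepted `def … : Prop`,
  unproved: Torisu's base case, the Legendrian realisation principle, Eliashberg's Legendrian
  surgery theorem with control of the induced contact structure, Gay's Prop. 2.8).
* `hT` is being PROVED summit-side (crux `ConvexBisection.AcyclicBisectionExists`, line
  `modp-braid-orbits`: nodes T1 `helper_isLefschetzHandlebody_of_split`, KOB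
  `helper_kasOpenBook_of_seamFunction`, T3 `node_T3_dualPresentation` of
  `Summits/SmoothPoincare4/…/ConvexBisectionAcyclicBisectionExistsSteinRealisationReduction.lean`,
  whose theorem `steinRealisation_of_nodes` assembles exactly the data of `hT` before invoking S2);
  that topology lives under `Summits/` and is not importable here.  Once it is available in
  `Literature/Topology/FourManifolds/` and S2 is discharged,
  `steinRealisation_of_sorted_modelsOnFibred_holds` is this theorem applied to the two proofs.

## Design note for a future discharge of S2: its base case on the tree's `Base g` (2026-08-17)

A sketch, used by no proof here, recorded by the discharge seat of NF6 for S2's future seat.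
What the tree already has for item (v) of S2's review (`LefschetzSteinOpenBook.lean`): transport
of Stein structures, boundary plane fields and Kas open books along compatible diffeomorphisms
(`LefschetzSteinOpenBookTransport.lean`: one model per attaching datum suffices), isotopy
extension over a collar (`BoundaryData.exists_diffeomorph_comp_incl_eq_of_isDiffeotopicToId`,
`CollarExtension.lean`; `AmbientIsotopy.isDiffeotopicToId`, `DiffeotopyProofs.lean`), Gray
stability (`GrayStability_holds`) and Giroux's contact path (`GirouxContactPath_holds`); Stein
structures on regular sublevel sets `{Ψ ≤ c} ⊂ ℂ²` of strictly `J₀`-plurisubharmonic functions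
(`SteinOneHandlebodies.lean` §§3–4: `sublevelJ`, `sublevelPhi`, the Levi form is the flat one),
and `Base g` IS such a `RegularSublevel` (`LefschetzBaseRegular.lean`, `rho = ‖w‖² + eta ‖x‖²`,
`w = y² − x^{2g+1} − 1`) — but Levi-FLAT along its vertical boundary `{‖w‖ = 1/2, ‖x‖ < 2}`
(foliated by the pages), so no Stein structure on `Base g` has `J = J₀` there (maximum principle on
a page), and the base case `h = ∅` of S2 needs a deformed model.  Sketch (ε' ≪ ε ≪ 1, `χ(s) = 1`
for `s ≤ (2−2δ)²`, `χ(s) = 0` for `s ≥ (2−δ)²`):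
* MODEL `Ω = {Ψ ≤ 1/4}`, `Ψ = ‖w‖² + eta ‖x‖² + ε‖x‖² + ε' χ(‖x‖²) ‖y‖²`, a regular sublevel set,
  strictly `J₀`-psh on `Ω` (on `‖x‖ ≥ 2 − 2δ` one has `‖y‖² = ‖1 + w + x^{2g+1}‖ ≥ c₀ > 0`, so
  `(w, x)` are local holomorphic coordinates and `|dw(v)|² + ε|dx(v)|²` dominates the `O(ε')`
  cut-off terms; on `‖x‖ ≤ 2 − 2δ`, `χ = 1` and `ε|dx(v)|² + ε'|dy(v)|²` does), whence a Stein
  structure `(sublevelJ, Ψ|_Ω)` on `Ω` by `SteinOneHandlebodies.lean` §§3–4;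
* GIROUX FORM `α = −½ dΨ ∘ J₀` restricted to `∂Ω` (kernel = complex tangencies): on a strictly
  pseudoconvex level set the Reeb field of `α` is `R = 2 J₀∇Ψ/‖∇Ψ‖²` for the Levi metric
  `h(u, v) = −½ ddᶜΨ(u, J₀v)`, and for `θ = arg w` (holomorphic `w`) `dθ(J₀v) = d log‖w‖ (v)`, so
  Giroux's page condition `dθ(R) > 0` reads `h*(d‖w‖², dΨ) > 0` on `∂Ω ∖ {w = 0}`; on
  `‖x‖ ≥ 2 − δ` (which contains the binding `{w = 0} ∩ ∂Ω`) `Ψ = ‖w‖² + G(x)` in the holomorphic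
  coordinates `(w, x)`, `h` is block-diagonal, `h*(d‖w‖², dG) = 0` and the condition holds with no
  estimate; on `‖x‖ ≤ 2 − δ`, `‖w‖ ≥ 1/3` and `|h*(d‖w‖², d(Ψ − ‖w‖²))| = O(√ε + ε'/√ε)` against
  `|d‖w‖²|²_{h*} ≥ 4‖w‖²(1 − O(ε))`; the pointwise step "a vector `R` with `ι_R dα = 0`, `α(R) > 0`,
  `dθ(R) > 0` gives the `pages` clause of `OpenBook.IsGirouxForm` at `y`" is linear algebra
  (`α ∧ dα (n, u, v) = (dθ(n)/dθ(R)) α(R) dα(u, v)` for `u, v ∈ ker dθ`); the binding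
  `{w = 0} ∩ ∂Ω` is transverse (`α ≠ 0` on it since the fibre `{w = 0}` meets `∂Ω` transversally);
* IDENTIFICATION `Base g ≅ Ω` preserving `arg w` and `{w = 0}` (so that the Kas open book of
  `bBase g` is carried to `({w = 0}, w/‖w‖)` on `∂Ω`): all `Ω_t = {‖w‖² + eta + t(ε‖x‖² + ε'χ‖y‖²)
  ≤ 1/4}`, `t ∈ [0, 1]`, are the superlevel sets `{τ ≥ t}` of one smooth function
  `τ = (1/4 − ‖w‖² − eta ‖x‖²)/(ε‖x‖² + ε'χ‖y‖²)` (denominator `> 0`: at `x = 0`, `‖y‖² ≥ 1/2`),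
  and the flow of `Y/dτ(Y)` for a vector field
  `Y = −w·(w̄_x, w̄_y)/‖∇w‖² + μ·(fibrewise gradient of τ)` with `dw(Y) = −w` (hence `Y`
  preserves `arg w` and `{w = 0}`; `dw ≠ 0` on `Base g`) and `dτ(Y) > 0` on the slab
  `{0 ≤ τ ≤ 1}` (`μ` large, by compactness: where the fibre of `w` is tangent to `∂Ω_t` one has
  `‖w‖ ≥ 1/3` and `eta' = 0`, so the radial part alone gives `dτ(Y) > 0` there) is the
  regular-interval diffeomorphism `{τ ≥ 0} = Base g → {τ ≥ 1} = Ω`.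
Then S2 for `h = ∅` follows on the model `(Ω, jA = that diffeomorphism)` and is transported to
every model by `palf_stein_supportedByBoundaryOpenBook_of_models`; the positivity clause
(`IsPosBdryFrame`) is the positivity of `α ∧ dα` on complex-positive boundary frames of a strictly
pseudoconvex boundary.  Items (ii)–(iv) of S2's review (Legendrian realisation, Eliashberg's handle
with contact control, Gay's Prop. 2.8) are untouched by this note.

## References
* R. İ. Baykur, *Kähler decomposition of 4-manifolds*, Algebr. Geom. Topol. 6 (2006) 1239–1265,
  proof of Thm. 5.1, pp. 13–14 (arXiv:math/0601396). [Baykur2006]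
* S. Akbulut, B. Ozbagci, *Lefschetz fibrations on compact Stein surfaces*, Geom. Topol. 5 (2001),
  Thm. 5. [AkbulutOzbagci2001]
* D. T. Gay, *Explicit concave fillings of contact three-manifolds*, Math. Proc. Camb. Phil. Soc.
  133 (2002), Prop. 2.8. [Gay2002]
* A. Kas, *On the handlebody decomposition associated to a Lefschetz fibration*, Pacific J. Math.
  89 (1980), 89–104. [Kas1980]
-/

noncomputable section

open scoped Manifold ContDiff Topology
open Set Function
open Literature.Topology.FourManifolds Literature.Topology.FourManifolds.HandleAttachingMap
  Literature.Topology.FourManifolds.LefschetzBase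

namespace Literature.Geometry.Symplectic

/-- **NF6 `steinRealisation_of_sorted_modelsOnFibred` from a dual Kas presentation and the named
fact S2 `palf_stein_supportedByBoundaryOpenBook`** (Baykur 2006, proof of Thm. 5.1, pp. 13–14).
Hypothesis `hT` (the topological half of the printed proof, p. 13: *"both PALFs induce the same
open book decomposition on their boundaries"*): every sorted allowable fibred model
`ModelsOnFibred M g (P ++ N)` yields `M = X₁ ∪_φ W₂` with `X₁ = X(F; P)`
(`IsLefschetzHandlebody g P X₁`) and positive allowable presentations `(h₁, D₁)` of `X₁` and
`(h₂, D₂)` of `W₂` over `Base g`, ONE open book `ob` on `∂X₁` which is the Kas open book of both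
(`IsKasOpenBookOf`, the second through `b₂.incl ∘ φ`), a seam point with a common frame positive
for both complex boundary orientations (`IsPosBdryFrame`), and `∂X₁` connected.  Hypothesis `hS2`:
the named fact S2 (p. 14: *"By [LP, AO], both `X₊` and `−X₋` admit Stein structures … compatible"*).
Proof: S2 on the first presentation gives `S₁, α₁`; S2 on the second, read on
`reindexBoundaryData b₂ φ`, gives `S₂, α₂`, a Giroux form for the plane field pulled back along `φ`
(chain rule for `boundaryPlaneField`); the sign clause propagates from the seam point over the
connected seam (`wedge₁₂_mextDeriv_pos_iff_of_exists`). [cite: Baykur2006, Thm. 5.1 (proof, pp. 13–14)] -/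
theorem steinRealisation_of_sorted_modelsOnFibred_of_dualKasPresentation
    (hT : ∀ (M : Type) [TopologicalSpace M] [T2Space M] [SecondCountableTopology M]
      [ChartedSpace (EuclideanSpace ℝ (Fin 4)) M] [IsManifold (𝓡 4) ∞ M] (g : ℕ)
      (P N : List ((Fin g ⊕ Fin g → ℤ) × Bool)),
      ModelsOnFibred M g (P ++ N) → (∀ x ∈ P, x.2 = true) → (∀ x ∈ N, x.2 = false) →
      (∀ x ∈ P ++ N, x.1 ≠ 0) →
      ∃ (X₁ : Type) (_ : TopologicalSpace X₁) (_ : T2Space X₁) (_ : SecondCountableTopology X₁)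
        (_ : CompactSpace X₁) (_ : ChartedSpace (EuclideanHalfSpace 4) X₁)
        (_ : IsManifold (𝓡∂ 4) ∞ X₁)
        (ι₁ : Type) (_ : Finite ι₁) (h₁ : ι₁ → HandleAttachingMap 3 2 (Base g))
        (D₁ : MultiAttachmentData h₁ (𝓡∂ 4) X₁)
        (W₂ : Type) (_ : TopologicalSpace W₂) (_ : T2Space W₂) (_ : SecondCountableTopology W₂)
        (_ : CompactSpace W₂) (_ : ChartedSpace (EuclideanHalfSpace 4) W₂)
        (_ : IsManifold (𝓡∂ 4) ∞ W₂)
        (ι₂ : Type) (_ : Finite ι₂) (h₂ : ι₂ → HandleAttachingMap 3 2 (Base g))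
        (D₂ : MultiAttachmentData h₂ (𝓡∂ 4) W₂)
        (b₁ : BoundaryData (𝓡∂ 4) X₁ (𝓡 3)) (b₂ : BoundaryData (𝓡∂ 4) W₂ (𝓡 3))
        (φ : b₁.carrier ≃ₘ⟮𝓡 3, 𝓡 3⟯ b₂.carrier) (ob : OpenBook b₁.carrier),
        IsLefschetzHandlebody g P X₁ ∧ IsBoundaryGluing b₁ b₂ φ (𝓡 4) M ∧
        (∀ i, ∃ c : ℂ, ‖c‖ = 1 ∧ ∀ θ, (h₁ i).attachingCircle θ ∈ page g c) ∧
        (∀ i, shadow g (h₁ i).attachingCircle (h₁ i).continuous_attachingCircle ≠ 0) ∧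
        (∀ i, pageTwisting g (h₁ i).attachingCircle (h₁ i).attachingFraming = -1) ∧
        (∀ j, ∃ c : ℂ, ‖c‖ = 1 ∧ ∀ θ, (h₂ j).attachingCircle θ ∈ page g c) ∧
        (∀ j, shadow g (h₂ j).attachingCircle (h₂ j).continuous_attachingCircle ≠ 0) ∧
        (∀ j, pageTwisting g (h₂ j).attachingCircle (h₂ j).attachingFraming = -1) ∧
        IsKasOpenBookOf g h₁ D₁ b₁.incl ob ∧ IsKasOpenBookOf g h₂ D₂ (b₂.incl ∘ φ) ob ∧
        (∃ (y : b₁.carrier) (a₁ : ↥(coresComplement h₁)) (a₂ : ↥(coresComplement h₂))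
            (uu : Fin 3 → EuclideanSpace ℝ (Fin 3)) (v₁ v₂ : Fin 3 → EuclideanSpace ℝ (Fin 4)),
          b₁.incl y = D₁.jA a₁ ∧ b₂.incl (φ y) = D₂.jA a₂ ∧
          (∀ k, mfderiv (𝓡 3) (𝓡∂ 4) b₁.incl y (uu k) = mfderiv (𝓡∂ 4) (𝓡∂ 4) D₁.jA a₁ (v₁ k)) ∧
          (∀ k, mfderiv (𝓡 3) (𝓡∂ 4) (b₂.incl ∘ φ) y (uu k) =
            mfderiv (𝓡∂ 4) (𝓡∂ 4) D₂.jA a₂ (v₂ k)) ∧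
          IsPosBdryFrame h₁ a₁ v₁ ∧ IsPosBdryFrame h₂ a₂ v₂) ∧
        ConnectedSpace b₁.carrier)
    (hS2 : palf_stein_supportedByBoundaryOpenBook) :
    steinRealisation_of_sorted_modelsOnFibred := by
  intro M _ _ _ _ _ g P N hM hP hN hnz
  -- the dual Kas presentation of the sorted fibred model
  obtain ⟨X₁, _, _, _, _, _, _, ι₁, _, h₁, D₁, W₂, _, _, _, _, _, _, ι₂, _, h₂, D₂, b₁, b₂, φ, ob,
    hLH, hglue, hpage₁, hsh₁, htw₁, hpage₂, hsh₂, htw₂, hkas₁, hkas₂, hseam, hconn⟩ :=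
    hT M g P N hM hP hN hnz
  haveI : ConnectedSpace b₁.carrier := hconn
  -- (S2) for the presentation of `X₁`
  obtain ⟨S₁, α₁, hG₁, hO₁⟩ := hS2 g ι₁ X₁ h₁ D₁ b₁ ob hpage₁ hsh₁ htw₁ hkas₁
  -- (S2) for the presentation of `W₂`, read on the re-indexed boundary datum (carrier `∂X₁`,
  -- inclusion `b₂.incl ∘ φ`)
  obtain ⟨S₂, α₂, hG₂', hO₂⟩ :=
    hS2 g ι₂ W₂ h₂ D₂ (reindexBoundaryData b₂ φ) ob hpage₂ hsh₂ htw₂ hkas₂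
  -- chain rule: the NF6 plane field `y ↦ (ξ₂ (φ y)).comap dφ_y` IS the boundary plane field of the
  -- re-indexed datum
  have hchain : (fun y => (boundaryPlaneField S₂.J b₂ (φ y)).comap
      (mfderiv (𝓡 3) (𝓡 3) φ y).toLinearMap :
        b₁.carrier → Submodule ℝ (EuclideanSpace ℝ (Fin 3))) =
      boundaryPlaneField S₂.J (reindexBoundaryData b₂ φ) := by
    funext y
    have hb : MDifferentiableAt (𝓡 3) (𝓡∂ 4) b₂.incl (φ y) :=
      (b₂.isSmoothEmbedding.contMDiff (φ y)).mdifferentiableAt (by simp)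
    have he : MDifferentiableAt (𝓡 3) (𝓡 3) φ y := (φ.contMDiff y).mdifferentiableAt (by simp)
    have hcomp : mfderiv (𝓡 3) (𝓡∂ 4) (b₂.incl ∘ φ) y =
        (mfderiv (𝓡 3) (𝓡∂ 4) b₂.incl (φ y)).comp (mfderiv (𝓡 3) (𝓡 3) φ y) := mfderiv_comp y hb he
    ext v
    show mfderiv (𝓡 3) (𝓡∂ 4) b₂.incl (φ y) (mfderiv (𝓡 3) (𝓡 3) φ y v) ∈
        contactPlane S₂.J (b₂.incl (φ y)) ↔
      mfderiv (𝓡 3) (𝓡∂ 4) (b₂.incl ∘ φ) y v ∈ contactPlane S₂.J (b₂.incl (φ y))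
    rw [hcomp]
    rfl
  have hG₂ : ob.IsGirouxForm (fun y => (boundaryPlaneField S₂.J b₂ (φ y)).comap
      (mfderiv (𝓡 3) (𝓡 3) φ y).toLinearMap) α₂ := by
    rw [hchain]
    exact hG₂'
  -- the sign clause: both forms are positive on the common frame at the seam point, and the seam
  -- is connected
  have hsign : ∀ y u v w, 0 < wedge₁₂ (α₁ y) (Literature.Geometry.Kaehler.mextDeriv α₁ y) u v w ↔
      0 < wedge₁₂ (α₂ y) (Literature.Geometry.Kaehler.mextDeriv α₂ y) u v w := by
    obtain ⟨y, a₁, a₂, uu, v₁, v₂, hy₁, hy₂, hu₁, hu₂, hpos₁, hpos₂⟩ := hseam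
    exact wedge₁₂_mextDeriv_pos_iff_of_exists hG₁.smooth hG₂.smooth hG₁.contact hG₂.contact
      ⟨y, uu 0, uu 1, uu 2, hO₁ y a₁ uu v₁ hy₁ hu₁ hpos₁, hO₂ y a₂ uu v₂ hy₂ hu₂ hpos₂⟩
  exact ⟨X₁, inferInstance, inferInstance, inferInstance, inferInstance, inferInstance, inferInstance,
    W₂, inferInstance, inferInstance, inferInstance, inferInstance, S₁, S₂, b₁, b₂, φ, ob, α₁, α₂,
    hglue, hG₁, hG₂, hsign, hLH⟩

end Literature.Geometry.Symplectic

end
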